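import Summits.QuantumFields.YangMills.Theorems.BalabanUVNodesN15CurvedGluingSmoothCutDressedFarDefectTwoGrid
import HarnessLib

/-!
# Route «BalabanUVNodes» (cluster K4 «SpineRates»), Track-A DAG node N15 = NE2, BACKGROUND LAYER — THE CUT PERTURBATION IS SMALL WHEN THE SPECIES IS SMALL ON THE CUBE ((3.35)): the `hV` ∕ `hDV`
# slots of the per-cube-gauge capstones (`…SmoothCutDressedGluedGauged`, `…GluedDefectGauged`) for a STRUCTURAL perturbation `V̂_f = unstackM C A + N_V∘pr₀` cut to the cube,
# `Ṽ = M_ψV̂_fC_χ = unstackM (χC) (χA) + (M_ψN_VM_χ)∘pr₀`, from row letters of the species coefficients WHERE `χ ≠ 0` only and the letter of the cut nonlocal part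

Cell `pub-ymgap`, seat `pub-ymgap-dag-n15-w3` (WIDTH SEAT 3∕3 on node N15, director-ym №197 ∕ HUMAN RULING D-0149; plan `W-SEAT-START-LIST.md` §n15 item 3 «LG-vector + background layers at
GENERAL small-field U» — fifty-first piece; the last producer of this seat's g5 per-cube-gauge package: 47 one-grid capstone, 48 two-grid capstone, 49∕50 far-defect rows, 51 cut letters).
`bears_on: R4∕N15 · K3⁸ SpineGivenEndpointR13SepCoPHV (stmt-QuantumFields-27366; K3⁷ 20544 aside — KEY MAP v2)`.  Filed `--kind proof --supports stmt-QuantumFields-27366 --as helper` —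
COUNT-NEUTRAL.  Theorems only; 0 `def`, 0 `sorry`.  Imports BY NAME this seat's `…SmoothCutDressedFarDefectTwoGrid` (`projO_comp_jetCut`, `unstackM_comp_jetCut`; through it B1b `unstackM` ∕
`hasMaj_unstackM` ∕ `hasMaj_idef_unstackM`, B2 `projO`, lit `idef_comp` ∕ `idef_add` ∕ `hasMaj_pull` ∕ `diagK_le_decay`, dag-n15-c `hasMaj_comp_diag`); nothing in the tree is modified, no landed
name re-declared.

WHY.  [Balaban1985BackgroundPropagators] (3.35) p. 396: in the cube's gauge `U^{u_□} = e^{iηA}` with `|A|` small ON THE ENLARGED CUBE ONLY.  The per-cube-gauge capstones display the cut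
perturbation's letter `V k ≤ Re^{−δ_Vd}` (`hV`) and, on two grids, its η-defect `𝔇(V′ k, V k) ≤ oe^{−δ_Vd}` (`hDV`); files 49∕50 supply the far-defect rows; THIS FILE supplies `hV` and `hDV` for
the structural perturbation from LOCAL data: ★ `cutPert_structural_eq` — `M_ψ(unstackM C A + N_V∘pr₀)C_χ = unstackM (χC) (χA) + (M_ψN_VM_χ)∘pr₀` (`ψχ = χ`; `mulOp_comp_unstackM`); ★★
`hasMaj_cutPert_structural_of_local` — row sums of `C(x)`, `A_μ(x)` bounded by `r` WHEREVER `χ(x) ≠ 0` (nothing asked off the cube), `|χ| ≤ 1`, and the cut nonlocal letter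
`M_ψN_VM_χ ≤ R_Ne^{−δ_Vd}` give `Ṽ ≤ (r(1 + |J|) + R_N)e^{−δ_Vd}` (B1b `hasMaj_unstackM` on the cut coefficients, `diagK_le_decay`, `pr₀ ≤ diag 1`); ★★ `hasMaj_idef_cutPert_structural_of_local` —
the η-defect from the cut coefficients' row fits across `π` and the displayed two-grid defect of the cut nonlocal parts (`𝔇(pr₀′, pr₀) = 0`: `idef_projO_none_eq_zero`):
`𝔇(Ṽ′, Ṽ) ≤ (o(1 + |J|) + o_N)e^{−δ_Vd}`.  With files 47–50 this closes the per-cube-gauge package of this seat: every displayed slot of the capstones that concerns the PERTURBATION is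
inhabited from data on the cube (species rows∕fits where `χ ≠ 0`) plus letters of the nonlocal part (cut, far, two-grid) — the exact content of (3.35)'s «small on □̃».

HONEST FRAMING ∕ LIMITS.  Finite-dimensional bookkeeping over DISPLAYED local row letters∕fits of the species coefficients and displayed letters of the nonlocal part; the species
coefficients of `U^{u_□}` and their letters from the (3.35) bound, the gauges `u_□`, and `N_V`'s letters are NOT produced here (located: dag-n15-w2 g5's `…SpeciesUN` ∕ axial-gauge ∕
`…PerturbationLetters…UN` files — their GLOBAL-letter lemmas specialise to the cut coefficients; Bałaban's `P₁(A)` letters (3.49)∕(3.68)∕(3.77), lane-held); nothing of [B5]∕[B6]∕[B9]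
asserted ((3.35), (3.42), (3.52), (3.76)–(3.77), Thm 3.14 = SHAPES ∕ TEMPLATE).  NE2⁺ NOT PRINTED, NOT proved; N15 NOT discharged; K3⁸ OPEN, skeleton v6 untouched; counts of record UNMOVED
(typed 28∕28 · discharged 5∕27); one finite 𝕋⁴ at fixed ε — NOT infinite volume, NOT OS on ℝ⁴, NOT a mass gap, NOT Clay; R4 closes the conditional finite-𝕋⁴ rung `BalabanLadder.UV` only.
Restate-immune (no Theses import).
-/

set_option autoImplicit false

noncomputable section
open scoped BigOperators Matrix
open Finset

namespace Summit.QuantumFields.YangMills.BalabanUVNodes.N15.CurvedSpecies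

open Literature.MathematicalPhysics.QuantumFieldTheory.Balaban1983to89
open Literature.MathematicalPhysics.QuantumFieldTheory.Balaban1983to89.B11SectG (BlockNorm HasMaj hasMaj_zero)
open Literature.MathematicalPhysics.QuantumFieldTheory.Balaban1983to89.B6Prop26Gluing (mulOp mulOp_apply)
open Literature.MathematicalPhysics.QuantumFieldTheory.Balaban1983to89.T4EtaRateDefect (idef idef_apply idef_comp idef_add idef_zero)
open Literature.MathematicalPhysics.QuantumFieldTheory.Balaban1983to89.T4EtaRateCoeffDefect (pull pull_apply diagK diagK_nonneg diagK_le_decay hasMaj_pull)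
open Summit.QuantumFields.YangMills.BalabanUVNodes.N15.MatrixSpecies (mmulOp liftBlk liftMap)
open Summit.QuantumFields.YangMills.BalabanUVNodes.N15.BackgroundLayer (projO projO_apply blkPair liftPair unstackM unstackM_apply hasMaj_unstackM hasMaj_idef_unstackM)
open Summit.QuantumFields.YangMills.BalabanUVNodes.N15.Gluing (hasMaj_comp_diag mulOp_comp_mulOp)

variable {X X' ι J : Type} [Fintype ι] [Fintype J]

/-! ## §1 Algebra: the cut perturbation of a structural perturbation -/

section Algebra

omit [Fintype J] in
/-- A site cut-off in front of the species rescales its coefficients: `M_a∘unstackM C A = unstackM (a·C) (a·A)`. [cite: Balaban1985BackgroundPropagators, (3.52) p.400 (shape)] -/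
theorem mulOp_comp_unstackM [Fintype J] (a : X → ℝ) (C : X → Matrix ι ι ℝ) (A : J → X → Matrix ι ι ℝ) :
    mulOp (fun p : X × ι => a p.1) ∘ₗ unstackM C A = unstackM (fun x => a x • C x) (fun μ x => a x • A μ x) := by
  refine LinearMap.ext fun f => funext fun p => ?_
  simp only [LinearMap.comp_apply, mulOp_apply, unstackM_apply, Finset.mul_sum, mul_add, Matrix.smul_apply, smul_eq_mul]
  congr 1
  · exact Finset.sum_congr rfl fun j _ => by ring
  · exact Finset.sum_congr rfl fun μ _ => Finset.sum_congr rfl fun j _ => by ring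

/-- ★ **THE CUT PERTURBATION OF A STRUCTURAL PERTURBATION**: `M_ψ∘(unstackM C A + N_V∘pr₀)∘C_χ = unstackM (χC) (χA) + (M_ψN_VM_χ)∘pr₀` when `ψχ = χ` — the species cut to the cube is the
species with cut coefficients; the nonlocal part is cut on both sides. [cite: Balaban1985BackgroundPropagators, (3.35) p.396, (3.52) p.400, (3.76)–(3.77) p.406 (shapes)] -/
theorem cutPert_structural_eq (C : X → Matrix ι ι ℝ) (A : J → X → Matrix ι ι ℝ) (NV : (X × ι → ℝ) →ₗ[ℝ] (X × ι → ℝ)) {χX ψX : X → ℝ}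
    (hψχ : mulOp (fun p : X × ι => ψX p.1) ∘ₗ mulOp (fun p : X × ι => χX p.1) = mulOp (fun p : X × ι => χX p.1)) :
    mulOp (fun p : X × ι => ψX p.1) ∘ₗ (unstackM C A + NV ∘ₗ projO none) ∘ₗ mulOp (fun q : (X × ι) × Option J => χX q.1.1) =
      unstackM (fun x => χX x • C x) (fun μ x => χX x • A μ x) + (mulOp (fun p : X × ι => ψX p.1) ∘ₗ NV ∘ₗ mulOp (fun p : X × ι => χX p.1)) ∘ₗ projO none := by
  rw [LinearMap.add_comp, LinearMap.comp_add, unstackM_comp_jetCut, ← LinearMap.comp_assoc, hψχ, mulOp_comp_unstackM]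
  simp only [LinearMap.comp_assoc, projO_comp_jetCut]

omit [Fintype ι] [Fintype J] in
/-- The propagator-component projections of the two grids intertwine the pull-backs EXACTLY: `𝔇(pr₀′, pr₀) = 0`. [folklore] -/
theorem idef_projO_none_eq_zero (π : X' → X) :
    idef (pull (liftPair (liftMap π ι))) (pull (liftMap π ι)) (projO (none : Option J) : ((X' × ι) × Option J → ℝ) →ₗ[ℝ] (X' × ι → ℝ)) (projO none) = 0 := by
  refine LinearMap.ext fun f => funext fun p => ?_
  simp only [idef_apply, LinearMap.zero_apply, Pi.zero_apply, Pi.sub_apply, projO_apply, pull_apply, sub_self]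

end Algebra

/-! ## §2 Letters: the cut perturbation is small when the species is small ON THE CUBE and the nonlocal part is small between the cuts -/

section Letters

variable [Fintype X] [Fintype X'] {g : B6.Geometry} (blk : X → g.Site) (π : X' → X) {C : X → Matrix ι ι ℝ} {A : J → X → Matrix ι ι ℝ}
  {C' : X' → Matrix ι ι ℝ} {A' : J → X' → Matrix ι ι ℝ} {NV : (X × ι → ℝ) →ₗ[ℝ] (X × ι → ℝ)} {NV' : (X' × ι → ℝ) →ₗ[ℝ] (X' × ι → ℝ)} {χX ψX : X → ℝ} {χX' ψX' : X' → ℝ}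

omit [Fintype X] [Fintype X'] in
/-- Row sums of cut coefficients from LOCAL row letters: `|χ| ≤ 1`, `Σ_j|C(x)_{ij}| ≤ r` wherever `χ(x) ≠ 0` ⟹ `Σ_j|(χ(x)C(x))_{ij}| ≤ r` everywhere (`r ≥ 0`). [folklore] -/
theorem rowSum_smul_le_of_local {r : ℝ} (hr : 0 ≤ r) (hχ1 : ∀ x, |χX x| ≤ 1) {M : X → Matrix ι ι ℝ} (hM : ∀ x, χX x ≠ 0 → ∀ i, ∑ j, |M x i j| ≤ r) (x : X) (i : ι) :
    ∑ j, |(χX x • M x) i j| ≤ r := by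
  by_cases hx : χX x = 0
  · simp [hx, hr]
  · have h1 : ∑ j, |(χX x • M x) i j| = |χX x| * ∑ j, |M x i j| := by
      rw [Finset.mul_sum]
      exact Finset.sum_congr rfl fun j _ => by rw [Matrix.smul_apply, smul_eq_mul, abs_mul]
    rw [h1]
    calc |χX x| * ∑ j, |M x i j| ≤ 1 * r := mul_le_mul (hχ1 x) (hM x hx i) (Finset.sum_nonneg fun j _ => abs_nonneg _) zero_le_one
      _ = r := one_mul r

omit [Fintype X'] in
/-- ★★ **THE CUT PERTURBATION's LETTER FROM SMALLNESS ON THE CUBE** (the `hV` slot of `…SmoothCutDressedGluedGauged` ∕ `…GluedDefectGauged`): if the species coefficients have row sums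
`≤ r` WHEREVER `χ ≠ 0` ((3.35): `U^{u_□}` small on the cube only), `|χ| ≤ 1`, `ψχ = χ`, and the nonlocal part cut between the cuts has the letter `M_ψN_VM_χ ≤ R_Ne^{−δ_Vd}`, then
`M_ψ(unstackM C A + N_V∘pr₀)C_χ ≤ (r(1 + |J|) + R_N)·e^{−δ_Vd}`. [cite: Balaban1985BackgroundPropagators, (3.35) p.396, (3.52) p.400, (3.76)–(3.77) p.406 (shapes)] -/
theorem hasMaj_cutPert_structural_of_local (hd0 : ∀ y : g.Site, g.dist y y = 0) {r RN δV : ℝ} (hr : 0 ≤ r) (hRN : 0 ≤ RN) (hχ1 : ∀ x, |χX x| ≤ 1)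
    (hC : ∀ x, χX x ≠ 0 → ∀ i, ∑ j, |C x i j| ≤ r) (hA : ∀ μ x, χX x ≠ 0 → ∀ i, ∑ j, |A μ x i j| ≤ r)
    (hψχ : mulOp (fun p : X × ι => ψX p.1) ∘ₗ mulOp (fun p : X × ι => χX p.1) = mulOp (fun p : X × ι => χX p.1))
    (hN : HasMaj (BlockNorm.ofBlocks g (liftBlk blk ι)) (BlockNorm.ofBlocks g (liftBlk blk ι)) (mulOp (fun p : X × ι => ψX p.1) ∘ₗ NV ∘ₗ mulOp (fun p : X × ι => χX p.1))
      (fun y y' => RN * Real.exp (-(δV * g.dist y y')))) :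
    HasMaj (BlockNorm.ofBlocks g (blkPair (liftBlk blk ι))) (BlockNorm.ofBlocks g (liftBlk blk ι))
      (mulOp (fun p : X × ι => ψX p.1) ∘ₗ (unstackM C A + NV ∘ₗ projO none) ∘ₗ mulOp (fun q : (X × ι) × Option J => χX q.1.1))
      (fun y y' => (r * (1 + Fintype.card J) + RN) * Real.exp (-(δV * g.dist y y'))) := by
  rw [cutPert_structural_eq C A NV hψχ]
  have h1 : HasMaj (BlockNorm.ofBlocks g (blkPair (liftBlk blk ι))) (BlockNorm.ofBlocks g (liftBlk blk ι)) (unstackM (fun x => χX x • C x) (fun μ x => χX x • A μ x))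
      (fun y y' => r * (1 + Fintype.card J) * Real.exp (-(δV * g.dist y y')) * 1) :=
    (hasMaj_unstackM (blk := blk) hr (rowSum_smul_le_of_local hr hχ1 hC) (fun μ => rowSum_smul_le_of_local hr hχ1 (hA μ))).mono fun y y' =>
      diagK_le_decay δV (fun _ => by positivity) (fun _ => le_of_eq (mul_one _).symm) hd0 y y'
  have hpr : HasMaj (BlockNorm.ofBlocks g (blkPair (liftBlk blk ι))) (BlockNorm.ofBlocks g (liftBlk blk ι)) (projO (none : Option J)) (diagK fun _ => (1 : ℝ)) :=
    hasMaj_pull (blkPair (liftBlk blk ι)) (fun p : X × ι => (p, (none : Option J)))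
  have h2 := hasMaj_comp_diag (liftBlk blk ι) (fun y y' => mul_nonneg hRN (Real.exp_nonneg _)) hN hpr
  refine (h1.add h2).mono fun y y' => le_of_eq ?_
  ring

/-- ★★ **THE CUT PERTURBATIONS' η-DEFECT FROM FITS ON THE CUBE** (the `hDV` slot of `…GluedDefectGauged`): the cut coefficients' row fits across `π` (`≤ o`, displayed where needed only since both
vanish off the cuts) and the displayed two-grid defect of the cut nonlocal parts `𝔇(M_{ψ′}N′_VM_{χ′}, M_ψN_VM_χ) ≤ o_Ne^{−δ_Vd}` give `𝔇(V̂′, V̂) ≤ (o(1 + |J|) + o_N)·e^{−δ_Vd}` (`𝔇(pr₀′, pr₀) = 0`).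
[cite: Balaban1985BackgroundPropagators, (3.42) p.397, Thm 3.14 pp.426–427 (template), (3.52) p.400] -/
theorem hasMaj_idef_cutPert_structural_of_local (hd0 : ∀ y : g.Site, g.dist y y = 0) {o oN δV : ℝ} (ho : 0 ≤ o) (hoN : 0 ≤ oN)
    (hψχ : mulOp (fun p : X × ι => ψX p.1) ∘ₗ mulOp (fun p : X × ι => χX p.1) = mulOp (fun p : X × ι => χX p.1))
    (hψχ' : mulOp (fun p : X' × ι => ψX' p.1) ∘ₗ mulOp (fun p : X' × ι => χX' p.1) = mulOp (fun p : X' × ι => χX' p.1))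
    (hfitC : ∀ x' i, ∑ j, |(χX' x' • C' x') i j - (χX (π x') • C (π x')) i j| ≤ o) (hfitA : ∀ μ x' i, ∑ j, |(χX' x' • A' μ x') i j - (χX (π x') • A μ (π x')) i j| ≤ o)
    (hDN : HasMaj (BlockNorm.ofBlocks g (liftBlk blk ι)) (BlockNorm.ofBlocks g (liftBlk (blk ∘ π) ι))
      (idef (pull (liftMap π ι)) (pull (liftMap π ι)) (mulOp (fun p : X' × ι => ψX' p.1) ∘ₗ NV' ∘ₗ mulOp (fun p : X' × ι => χX' p.1))
        (mulOp (fun p : X × ι => ψX p.1) ∘ₗ NV ∘ₗ mulOp (fun p : X × ι => χX p.1))) (fun y y' => oN * Real.exp (-(δV * g.dist y y')))) :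
    HasMaj (BlockNorm.ofBlocks g (blkPair (liftBlk blk ι))) (BlockNorm.ofBlocks g (liftBlk (blk ∘ π) ι))
      (idef (pull (liftPair (liftMap π ι))) (pull (liftMap π ι))
        (mulOp (fun p : X' × ι => ψX' p.1) ∘ₗ (unstackM C' A' + NV' ∘ₗ projO none) ∘ₗ mulOp (fun q : (X' × ι) × Option J => χX' q.1.1))
        (mulOp (fun p : X × ι => ψX p.1) ∘ₗ (unstackM C A + NV ∘ₗ projO none) ∘ₗ mulOp (fun q : (X × ι) × Option J => χX q.1.1)))
      (fun y y' => (o * (1 + Fintype.card J) + oN) * Real.exp (-(δV * g.dist y y'))) := by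
  rw [cutPert_structural_eq C A NV hψχ, cutPert_structural_eq C' A' NV' hψχ', idef_add, idef_comp (pull (liftPair (liftMap π ι))) (pull (liftMap π ι)) (pull (liftMap π ι)),
    idef_projO_none_eq_zero, LinearMap.comp_zero, zero_add]
  have h1 : HasMaj (BlockNorm.ofBlocks g (blkPair (liftBlk blk ι))) (BlockNorm.ofBlocks g (liftBlk (blk ∘ π) ι))
      (idef (pull (liftPair (liftMap π ι))) (pull (liftMap π ι)) (unstackM (fun x' => χX' x' • C' x') (fun μ x' => χX' x' • A' μ x')) (unstackM (fun x => χX x • C x) (fun μ x => χX x • A μ x)))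
      (fun y y' => o * (1 + Fintype.card J) * Real.exp (-(δV * g.dist y y')) * 1) :=
    (hasMaj_idef_unstackM (blk := blk) π ho hfitC hfitA).mono fun y y' => diagK_le_decay δV (fun _ => by positivity) (fun _ => le_of_eq (mul_one _).symm) hd0 y y'
  have hpr : HasMaj (BlockNorm.ofBlocks g (blkPair (liftBlk blk ι))) (BlockNorm.ofBlocks g (liftBlk blk ι)) (projO (none : Option J)) (diagK fun _ => (1 : ℝ)) :=
    hasMaj_pull (blkPair (liftBlk blk ι)) (fun p : X × ι => (p, (none : Option J)))
  have h2 := hasMaj_comp_diag (liftBlk blk ι) (fun y y' => mul_nonneg hoN (Real.exp_nonneg _)) hDN hpr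
  refine (h1.add h2).mono fun y y' => le_of_eq ?_
  ring

end Letters

end Summit.QuantumFields.YangMills.BalabanUVNodes.N15.CurvedSpecies

end
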